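import Literature.Computability.AlgebraicComplexity.DegreeBoundFibres
import Literature.RingTheory.MvPolynomial.MacaulayDeterminant

/-!
# Route BarrierLever — item `NaturalProofsAgainstAllLinearSizes` (stmt-ValiantsHypothesis-20156):
# the CAPSTONE of the Baur–Strassen × Macaulay argument, modulo one algebro-geometric count

Lean text authored by the cell planner seat `valiant-natproofs-p2` (gen 4, HOME/NaturalBS-p2g4.lean,
memo HOME/ROUTE-MEMO-p2-g4.md S1–S5), landed by the prover seat as a `--supports` helper of item
stmt-ValiantsHypothesis-20156 ("FSV-natural proofs against EVERY linear circuit size"), over the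
two Literature files landed for it: `DegreeBoundFibres.lean` (Strassen's degree bound in fibre
form: a finite gradient fibre of a restriction of `f` with more than `2^(k+3s)` points forces
`complexity f > s`) and `MacaulayDeterminant.lean` (`det M(∇ h) ≠ 0` certifies that the form `h`
has no nonzero singular point).

* `GenericGradientFibreCount k d` — THE ONE REMAINING INPUT, as a predicate used as a hypothesis
  (CLO *Using Algebraic Geometry* Ch. 3 Thm. (5.5): if the top forms of `G_1, …, G_k` have no common
  zero outside the origin, every system `G_i = c_i` has exactly `∏ deg G_i` solutions counted with
  multiplicity; plus generic smoothness in characteristic `0`, Hartshorne III Cor. 10.7: for generic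
  `c` all multiplicities are `1`), specialised to gradient systems: if `deg g ≤ d` and `∇(g_d)` has
  only the trivial common zero, SOME fibre of `∇g` is finite with at least `(d-1)^k` points. NOT
  proved here (nor in the tree).
* **`det_macaulay_grad_topForm_eq_zero`** — modulo that count: for `f` of circuit complexity `≤ s`
  and a restriction `g = f ∘ θ` to `k` coordinates (`θ i ∈ {X j} ∪ {0}`) of degree `≤ d` with
  `2^(k+3s) < (d-1)^k`, the Macaulay determinant of `∇(g_d)` VANISHES (the top form of every such
  restriction is a singular form).

What then remains for the item (memo §4a): the determinant as ONE fixed nonzero distinguisher in the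
coefficient variables (entries = integer multiples of single coefficients; nonzero at `Σ x_i^n / n`
by `Macaulay.det_macaulay_X_pow`; size via `complexity_detPoly_le`), and the arithmetic
`n ≥ n₀(c) ⇒ 2^(k+3cn) < (n-1)^k` for `k = ⌊3cn/(log₂(n-1)-1)⌋ + 1 ≤ n`.

WHAT THIS IS NOT: conditional on `GenericGradientFibreCount` (a TRUE classical statement, but a
hypothesis here); does not close the item; nothing about sizes `n^{1+ε}` and beyond.
-/

-- layout Summits/ValiantsHypothesis/ValiantsHypothesis forces the duplicated namespace component
set_option linter.dupNamespace false

noncomputable section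

namespace Summit.ValiantsHypothesis.ValiantsHypothesis.Theorems.BarrierLever.NaturalProofsAgainstAllLinearSizes

open MvPolynomial Literature.Computability.AlgebraicComplexity
open Literature.Computability.AlgebraicComplexity.DegreeBound Literature.RingTheory.MvPolynomial.Macaulay

/-- **The one remaining algebro-geometric input, as a predicate** (CLO *Using Algebraic Geometry*
Ch. 3 Thm. (5.5) + generic smoothness, Hartshorne III Cor. 10.7, specialised to gradient systems over
`ℂ`): if `deg g ≤ d` and the gradient of the degree-`d` component `g_d` has only the trivial common
zero, then some fibre `{x | ∇g(x) = c}` is finite with at least `(d-1)^k` points. A HYPOTHESIS of the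
capstone below; not proved in the tree. -/
def GenericGradientFibreCount (k d : ℕ) : Prop :=
  ∀ g : MvPolynomial (Fin k) ℂ, g.totalDegree ≤ d →
    (∀ ξ : Fin k → ℂ, (∀ i, eval ξ (pderiv i (homogeneousComponent d g)) = 0) → ξ = 0) →
    ∃ c : Fin k → ℂ, {x : Fin k → ℂ | ∀ i, eval x (pderiv i g) = c i}.Finite ∧
      (d - 1) ^ k ≤ {x : Fin k → ℂ | ∀ i, eval x (pderiv i g) = c i}.ncard

/-- **Capstone (memo S1–S5 assembled, modulo `GenericGradientFibreCount k d`)**: for `f` of circuit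
complexity `≤ s` and a restriction `g = f ∘ θ` to `k` coordinates (`θ i ∈ {X j} ∪ {0}`) of degree
`≤ d` with `2^(k+3s) < (d-1)^k`, the Macaulay determinant of `∇(g_d)` vanishes: otherwise `g_d` is a
smooth form (`Macaulay.eq_zero_of_det_macaulay_grad_ne_zero`), some gradient fibre of `g` has
`≥ (d-1)^k > 2^(k+3s)` points (the hypothesis), contradicting Strassen's degree bound
(`DegreeBound.complexity_gt_of_restricted_gradient_fibre`). -/
theorem det_macaulay_grad_topForm_eq_zero {n k d s : ℕ} (hAG : GenericGradientFibreCount k d)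
    (f : MvPolynomial (Fin n) ℂ) (hs : complexity f ≤ s)
    (θ : Fin n → MvPolynomial (Fin k) ℂ) (hθ : ∀ i, (∃ j, θ i = X j) ∨ θ i = 0)
    (hdeg : (aeval θ f).totalDegree ≤ d) (hk : 2 ^ (k + 3 * s) < (d - 1) ^ k) :
    (macaulay (d - 1) (fun i => pderiv i (homogeneousComponent d (aeval θ f)))).det = 0 := by
  by_contra hdet
  have hsmooth := eq_zero_of_det_macaulay_grad_ne_zero (homogeneousComponent d (aeval θ f))
    (homogeneousComponent_isHomogeneous d _) hdet
  obtain ⟨c, hfin, hcount⟩ := hAG (aeval θ f) hdeg hsmooth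
  have h := complexity_gt_of_restricted_gradient_fibre f θ hθ c hfin (hk.trans_le hcount)
  omega

end Summit.ValiantsHypothesis.ValiantsHypothesis.Theorems.BarrierLever.NaturalProofsAgainstAllLinearSizes

end
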